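import Summits.QuantumAdvantage.QuantumAdvantage.Theses.CubicForrelation
import Summits.QuantumAdvantage.QuantumAdvantage.Theorems.NearExactIsExact.Negative.ValueWitnesses

/-!
# Value witness for `NearExactIsExact` (stmt-QuantumAdvantage-14043): `Φ = 57/64` at `n = 14` (product of the `𝔽₈` chain)

Negative-side support (B2b-3 disprover seat `b2b-cforr-disprove`, 2026-08-18).  HONEST FRAMING: the value of this file is a
CERTIFICATE (an exactly evaluated forrelation value of an explicit cubic pair), not summit progress; moreover the pair is
MULTIPLICATIVE (a direct sum), so it says nothing new structurally — it only moves the `n = 14` entry of the per-`n` record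
table from `7/8` (`(fT,gT) ⊗` a bent quadratic pair) to `57/64`.

The pair is the direct sum of the `12`-bit `𝔽₈`-chain pair `(fC, gC)` of `F8ChainTwelve.lean` (`Φ = 57/64`) with the exact
`2`-bit pair `(x₁₂x₁₃, x₁₂x₁₃)` (`Φ = 1`): `g14 = gC(x₀..x₁₁) ⊕ x₁₂x₁₃`, `f14 = fC(x₀..x₁₁) ⊕ x₁₂x₁₃`, and forrelation is
multiplicative over direct sums, so `Φ(f14, g14) = 57/64 · 1 = 57/64` — here simply re-evaluated exactly
(`forrelation_f14_g14`).  `W_g14 ∈ {0 (2016×), ±128 (14336×), ±1024 (32×)}`: `g14` is not bent.  Records of non-exact cubic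
pairs now read `13/16 (8), 7/8 (10), 57/64 (12), 57/64 (14), 15/16 (16)` against the proved isolation thresholds
`7/8, 15/16, 15/16, 31/32, 63/64`.

`native_decide` evaluates the forrelation sum by the fast Walsh–Hadamard checker `fsumL` of `ValueWitnesses.lean`: the file is
`computational`.  References: Carlet 2021 §6.1; Aaronson–Ambainis 2018 §1.1.1 (forrelation).
-/

set_option linter.dupNamespace false -- D-0017: single-problem summit ⇒ `QuantumAdvantage.QuantumAdvantage` by design

namespace Summit.QuantumAdvantage.QuantumAdvantage.Theorems.NearExactIsExact.Negative.ProductFourteen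

open Literature.Computability.QuantumComplexity
open Summit.QuantumAdvantage.QuantumAdvantage.Theorems.SignedExactSliceIsLift.StubMoebius (isDegLeFun_xor isDegLeFun_and)
open Summit.QuantumAdvantage.QuantumAdvantage.Theorems.NearExactIsExact.Negative.SmallCases (fsumL forrelation_eq_fsumL)

/-- `g14 = gC ⊕ x₁₂x₁₃` (algebraic normal form, 22 monomials). [cite: Carlet2020, §6.1] -/
def g14 (x : Fin (7 + 7) → Bool) : Bool :=
  xor
    (xor
      (xor
        (xor (x 5 && (x 8 && x 11)) (x 4 && (x 8 && x 11)))
        (xor (x 5 && (x 7 && x 11)) (xor (x 3 && (x 7 && x 11)) (x 4 && (x 6 && x 11)))))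
      (xor
        (xor (x 5 && (x 8 && x 10)) (xor (x 3 && (x 8 && x 10)) (x 4 && (x 7 && x 10))))
        (xor (x 5 && (x 6 && x 10)) (xor (x 4 && (x 8 && x 9)) (x 5 && (x 7 && x 9))))))
    (xor
      (xor
        (xor (x 3 && (x 6 && x 9)) (x 0 && (x 4 && x 5)))
        (xor (x 1 && (x 3 && x 5)) (xor (x 2 && (x 3 && x 4)) (x 2 && x 5))))
      (xor
        (xor (x 1 && x 5) (xor (x 0 && x 5) (x 1 && x 4)))
        (xor (x 0 && x 4) (xor (x 0 && x 3) (x 12 && x 13)))))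


/-- `f14 = fC ⊕ x₁₂x₁₃` (algebraic normal form, 22 monomials). [cite: Carlet2020, §6.1] -/
def f14 (x : Fin (7 + 7) → Bool) : Bool :=
  xor
    (xor
      (xor
        (xor (x 2 && (x 8 && x 11)) (x 1 && (x 7 && x 11)))
        (xor (x 0 && (x 7 && x 11)) (xor (x 1 && (x 6 && x 11)) (x 1 && (x 8 && x 10)))))
      (xor
        (xor (x 0 && (x 8 && x 10)) (xor (x 2 && (x 7 && x 10)) (x 1 && (x 7 && x 10))))
        (xor (x 2 && (x 6 && x 10)) (xor (x 1 && (x 8 && x 9)) (x 2 && (x 7 && x 9))))))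
    (xor
      (xor
        (xor (x 0 && (x 6 && x 9)) (x 0 && (x 1 && x 5)))
        (xor (x 0 && (x 2 && x 4)) (xor (x 1 && (x 2 && x 3)) (x 2 && x 5))))
      (xor
        (xor (x 1 && x 5) (xor (x 1 && x 4) (x 2 && x 3)))
        (xor (x 1 && x 3) (xor (x 0 && x 3) (x 12 && x 13)))))


/-- A cubic monomial on `14` bits has degree `≤ 3`. [cite: Carlet2020, §2.2.1 Def. 6] -/
theorem isDegLeFun_mon3 (i j k : Fin (7 + 7)) :
    IsDegLeFun 3 (fun x : Fin (7 + 7) → Bool => (x i && (x j && x k))) :=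
  isDegLeFun_and (a := 1) (b := 2) (isDegLeFun_apply i le_rfl)
    (isDegLeFun_and (a := 1) (b := 1) (isDegLeFun_apply j le_rfl) (isDegLeFun_apply k le_rfl))

/-- A quadratic monomial on `14` bits has degree `≤ 3`. [cite: Carlet2020, §2.2.1 Def. 6] -/
theorem isDegLeFun_mon2 (i j : Fin (7 + 7)) :
    IsDegLeFun 3 (fun x : Fin (7 + 7) → Bool => (x i && x j)) :=
  (isDegLeFun_and (a := 1) (b := 1) (isDegLeFun_apply i le_rfl) (isDegLeFun_apply j le_rfl)).mono (by norm_num)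

/-- `g14` is cubic. [cite: Carlet2020, §2.2.1 Def. 6] -/
theorem isDegLeFun_g14 : IsDegLeFun 3 g14 := by
  unfold g14
  repeat (first
    | exact isDegLeFun_mon3 _ _ _
    | exact isDegLeFun_mon2 _ _
    | apply isDegLeFun_xor)

/-- `f14` is cubic. [cite: Carlet2020, §2.2.1 Def. 6] -/
theorem isDegLeFun_f14 : IsDegLeFun 3 f14 := by
  unfold f14
  repeat (first
    | exact isDegLeFun_mon3 _ _ _
    | exact isDegLeFun_mon2 _ _
    | apply isDegLeFun_xor)

/-- The forrelation sum of the product pair: `57/64 · 2²¹ = 1867776`. [folklore] -/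
theorem fsumL_f14_g14 : fsumL (7 + 7) f14 g14 = 1867776 := by native_decide

/-- **`Φ(f14, g14) = 57/64`** at `n = 14`. [folklore] -/
theorem forrelation_f14_g14 : forrelation f14 g14 = 57 / 64 := by
  rw [forrelation_eq_fsumL 7 f14 g14, fsumL_f14_g14]; norm_num

/-- **A non-exact cubic pair with `Φ = 57/64` on `14` bits.** [folklore] -/
theorem exists_cubic_pair_fourteen_57_64 :
    ∃ f g : (Fin (7 + 7) → Bool) → Bool, IsDegLeFun 3 f ∧ IsDegLeFun 3 g ∧ forrelation f g = 57 / 64 :=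
  ⟨f14, g14, isDegLeFun_f14, isDegLeFun_g14, forrelation_f14_g14⟩

/-- **No threshold below `57/64` isolates exactness at `n = 14`** (witness `(f14, g14)`). [folklore] -/
theorem not_isolation_below_57_64_fourteen {θ : ℝ} (hθ : θ < 57 / 64) :
    ¬ (∀ f g : (Fin (7 + 7) → Bool) → Bool, IsDegLeFun 3 f → IsDegLeFun 3 g →
        θ < forrelation f g → forrelation f g = 1) := by
  intro h
  have h1 := h f14 g14 isDegLeFun_f14 isDegLeFun_g14 (by rw [forrelation_f14_g14]; exact hθ)
  rw [forrelation_f14_g14] at h1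
  norm_num at h1

end Summit.QuantumAdvantage.QuantumAdvantage.Theorems.NearExactIsExact.Negative.ProductFourteen
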